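import Literature.AnabelianGeometry.EtaleTheta.SettingModelChiKummerData
import Literature.AnabelianGeometry.EtaleTheta.SettingModelChiThetaCusp
import HarnessLib

/-!
# The χ-twisted root model of [EtTh] §1 WITH A CUSP (R78 (B), F5c): the KUMMER DATA `KummerData.modelχ′`

Mochizuki, *The étale theta function …*, Publ. RIMS **45** (2009) [EtTh], §1, Prop. 1.3 / 1.5, PRIMS PDF pp. 21–23
[cite: MochizukiEtTh2009, Prop 1.5 p.23]: the Kummer map `K^× → H¹(G_K, Δ_Θ)`, `log(U)`, `log(Ü)`, `log(U)|_Ÿ = 2·log(Ü)`.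

Layer L2 of the abc-iut cell, R78 cluster, seat abc-iut-w5-d171 (gen 3; integrator abc-iut-L6-d6's GO 09:06:47Z, row
«SettingModelChiKummerDataCusp»): the TRANSCRIPTION of `SettingModelChiKummerData.lean` (F6 (c), `kummerDataχ` over
abc-iut-L2-t1's `ThetaSetting.modelχ p`) to abc-iut-w5-d029's cusped variant `ThetaSetting.modelχ′ p` (F5c,
`SettingModelChiThetaCusp.lean`).  The two records share the carrier `Π^tp_X = Γ ⋊_χ G_{ℚ_p}`, the augmentation, `toZ`,
the coverings `Y_N`/`Z_N` and — definitionally, `thetaKer_curveχ'_eq` — the theta quotient `(Π^tp_X)^Θ` with its centre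
`Δ_Θ`; they differ only in the cusp datum (`Pt := Unit`).  Hence EVERY ingredient of `kummerCoreχ` (abc-iut-L6-d6's
coordinates `deltaThetaCoordχ`, abc-iut-L2-t5's `cycEquiv`, the `y`-coordinate classes `logUχ`, `logUddχ` and their
restriction law) serves verbatim, and `kummerDataχ′ := (kummerCoreχ′).toKummerData` (the non-degeneracy
`logU ≠ 1`, `logÜ ≠ 1` of `SettingModelChiKummerDataNondeg` transports the same way; sequel).

HONEST FRAMING: SEMI-SYNTHETIC model; consistency/non-vacuity evidence for the typed interface ONLY (now at a setting
with `IsEtThOrigin` AND a cusp); `KHat := K^× ⊆ (K^×)^∧` honest sub-object; nothing of [EtTh] asserted; no side taken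
on [IUTchIII] Cor. 3.12.  Class (b) construction over the frozen interface (no interface clause touched).
-/

noncomputable section

namespace Literature.AnabelianGeometry.EtaleTheta.SettingModel

open Literature.AnabelianGeometry.SemiGraphs

variable (p : ℕ) [Fact p.Prime]

/-! ### Instance keys at the cusped model (cf. `SettingModelChiThetaCusp`, `SettingModelChiKummerData`) -/

/-- `Δ_Θ(modelχ′) ⊴ (Π^tp_X)^Θ`, keyed on `(modelχ′ p).DeltaTheta`. [cite: MochizukiEtTh2009, §1 p.12] -/
instance deltaTheta_modelχ'_normal : (ThetaSetting.modelχ' p).DeltaTheta.Normal :=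
  ThetaSetting.deltaTheta_normal _

/-- `Δ_Θ(modelχ′)` is commutative, keyed on `(modelχ′ p).DeltaTheta`. [cite: MochizukiEtTh2009, §1 p.12] -/
instance deltaTheta_modelχ'_isMulCommutative : IsMulCommutative (ThetaSetting.modelχ' p).DeltaTheta :=
  ThetaSetting.deltaTheta_comm _

/-- `Δ_Θ(curveχ′)` is commutative, keyed at the cusped curve's quotient. [cite: MochizukiEtTh2009, §1 p.12] -/
instance deltaThetaχ'_isMulCommutative : IsMulCommutative (CurveTheta.thetaToEll (curveχ' p)).ker :=
  ThetaSetting.deltaTheta_comm (ThetaSetting.modelχ' p)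

/-! ### The Kummer core and Kummer data of the cusped χ-model -/

/-- **The Kummer core of the cusped χ-twisted root model** — field-by-field the core of `modelχ` (same theta
quotient, same `Δ_Θ`-coordinates, same `y`-coordinate classes). [cite: MochizukiEtTh2009, Prop 1.5 p.23] -/
def kummerCoreχ' : (ThetaSetting.modelχ' p).KummerCore where
  augTheta := (kummerCoreχ p).augTheta
  continuous_augTheta := (kummerCoreχ p).continuous_augTheta
  augTheta_toTheta := (kummerCoreχ p).augTheta_toTheta
  coeffHom := (kummerCoreχ p).coeffHom
  continuous_coeffHom := (kummerCoreχ p).continuous_coeffHom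
  coeffHom_smul := (kummerCoreχ p).coeffHom_smul
  bijective_coeffHom := (kummerCoreχ p).bijective_coeffHom
  map_augTheta_gtpY := (kummerCoreχ p).map_augTheta_gtpY
  map_augTheta_gtpYdd := (kummerCoreχ p).map_augTheta_gtpYdd
  finiteDimensional_Kdd := (kummerCoreχ p).finiteDimensional_Kdd
  logU := (kummerCoreχ p).logU
  logUdd := (kummerCoreχ p).logUdd
  res_logU := (kummerCoreχ p).res_logU

/-- The cusped core has the same `(Π^tp_X)^Θ → G_{ℚ_p}` (= `CurveTheta.augTheta (curveχ′ p)`, definitionally).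
[cite: MochizukiEtTh2009, §1 p.12] -/
theorem kummerCoreχ'_augTheta : (kummerCoreχ' p).augTheta = CurveTheta.augTheta (curveχ' p) := rfl

/-- **The Kummer data of the cusped χ-twisted root model.** [cite: MochizukiEtTh2009, Prop 1.5 p.23] -/
def kummerDataχ' : (ThetaSetting.modelχ' p).KummerData := (kummerCoreχ' p).toKummerData

/-- `KummerData(modelχ′)` is inhabited — Kummer data at a setting with `IsEtThOrigin` AND a cusp.
[cite: MochizukiEtTh2009, Prop 1.5 p.23] -/
theorem nonempty_kummerData_modelχ' : Nonempty (ThetaSetting.modelχ' p).KummerData := ⟨kummerDataχ' p⟩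

/-- Its Kummer map is the tree's continuous Kummer map with coefficients `Λ(ℚ̄_p^×) ≅ Ẑ ≅ Δ_Θ`.
[cite: MochizukiEtTh2009, Prop 1.5 p.23] -/
theorem kummerDataχ'_kumY (x : (kummerCoreχ' p).invY) :
    (kummerDataχ' p).kumY x =
      (letI := (ThetaSetting.modelχ' p).unitsAction (kummerCoreχ' p).augTheta
       (kummerCoreχ' p).coeff.kummerContMap _ (kummerCoreχ' p).isOpen_stabilizer' x) :=
  rfl

/-- Kummer data at a setting satisfying `IsEtThOrigin` and possessing a cusp (joint non-vacuity witness).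
[cite: MochizukiEtTh2009, Prop 1.5 p.23] -/
theorem _root_.Literature.AnabelianGeometry.EtaleTheta.ThetaSetting.exists_isEtThOrigin_and_isCusp_and_kummerData :
    ∃ D : ThetaSetting p, D.IsEtThOrigin ∧ (∃ x : D.Pt, D.IsCusp x) ∧ Nonempty D.KummerData :=
  ⟨ThetaSetting.modelχ' p, ThetaSetting.modelχ'_isEtThOrigin p, exists_isCusp_modelχ' p,
    nonempty_kummerData_modelχ' p⟩

end Literature.AnabelianGeometry.EtaleTheta.SettingModel

end
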